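import Mathlib
import HarnessLib

/-!
# S1a — A5a support: GORDAN'S LEMMA FOR KERNELS — the degree-zero exponents form a finitely generated monoid

(crux stmt-ResolutionOfSingularities-15640 `WildQuotients.WildQuotientResolution`, line `Sketch`; S1 =
stmt-ResolutionOfSingularities-17941 `CyclicQuotientFourfolds`, S1a H3-scheme (res-L1-w45c-idea-2 `h123/H3-SCHEME.md`,
H4a `h123/S1aCoarseChart.lean` e175f20bf932428b: (G1a) `VeroneseNormalisation` «finite generation of ⊕ₙ (𝒥ₙ)₀ tⁿ over
𝒜 0 — Dickson/Gordan on the degree monoid»); res-L1-w45c-plan-1 ASSIGN 2026-08-27T21:22:26Z (A5a → res-D-pv-033).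
[OURS · L1 W4.5c] — NOT a statement of any manuscript; standard mathematics (Gordan's lemma, the kernel case; Dickson's
lemma is Mathlib's `Pi.wellQuotOrderedLE`/`WellQuasiOrderedLE.finite_of_isAntichain`); AI-produced, weaker than
expert review. Def-free. Prover res-D-pv-033.)

For an additive commutative group `ι` and degrees `δ : Fin m → ι`, the monoid
`M = {γ : Fin m → ℕ | ∑ γᵢ • δᵢ = 0}` is generated by FINITELY many of its elements:
**`exists_finset_kernel_generators`** — `∃ G : Finset (Fin m → ℕ)`, `G ⊆ M`, and every `γ ∈ M` is
`∑_{g ∈ G} n g • g` for some `n : (Fin m → ℕ) → ℕ`. (The minimal non-zero elements of `M` form an antichain for the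
product order — finite by Dickson — and generate, since `M` is closed under `γ − g` for `g ≤ γ`.)
-/

-- single-problem summit: the doubled namespace component `ResolutionOfSingularities` is forced
set_option linter.dupNamespace false

namespace Summit.ResolutionOfSingularities.ResolutionOfSingularities.Theorems.WildQuotientResolution.S1.CoarseChart

open Finset

variable {ι : Type*} [AddCommGroup ι] {m : ℕ}

/-- The degree of an exponent vector: `deg γ = ∑ γᵢ • δᵢ`. -/
private theorem deg_tsub_add (δ : Fin m → ι) {γ g : Fin m → ℕ} (h : g ≤ γ) :
    (∑ i, (γ - g) i • δ i) + ∑ i, g i • δ i = ∑ i, γ i • δ i := by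
  rw [← Finset.sum_add_distrib]
  refine Finset.sum_congr rfl fun i _ => ?_
  rw [← add_nsmul, Pi.sub_apply, tsub_add_cancel_of_le (h i)]

/-- The kernel is closed under `γ − g` for `g ≤ γ`. [folklore] -/
theorem kernel_tsub_mem (δ : Fin m → ι) {γ g : Fin m → ℕ} (h : g ≤ γ) (hγ : ∑ i, γ i • δ i = 0)
    (hg : ∑ i, g i • δ i = 0) : ∑ i, (γ - g) i • δ i = 0 := by
  have := deg_tsub_add δ h
  rw [hγ, hg, add_zero] at this
  exact this

/-- **Gordan's lemma for kernels.** The monoid `{γ : Fin m → ℕ | ∑ γᵢ • δᵢ = 0}` of degree-zero exponent vectors is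
generated by finitely many of its elements. [folklore; Gordan 1873 (kernel case), via Dickson's lemma] -/
theorem exists_finset_kernel_generators (δ : Fin m → ι) :
    ∃ G : Finset (Fin m → ℕ), (∀ g ∈ G, ∑ i, g i • δ i = 0) ∧
      ∀ γ : Fin m → ℕ, ∑ i, γ i • δ i = 0 →
        ∃ n : (Fin m → ℕ) → ℕ, γ = ∑ g ∈ G, n g • g := by
  classical
  -- the minimal non-zero elements of the kernel
  set M : Set (Fin m → ℕ) := {γ | ∑ i, γ i • δ i = 0} with hM
  set A : Set (Fin m → ℕ) := {g | g ∈ M ∧ g ≠ 0 ∧ ∀ g' ∈ M, g' ≠ 0 → g' ≤ g → g' = g} with hA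
  have hanti : IsAntichain (· ≤ ·) A := by
    intro a ha b hb hab hle
    exact hab (hb.2.2 a ha.1 ha.2.1 hle)
  have hfin : A.Finite := WellQuasiOrderedLE.finite_of_isAntichain hanti
  refine ⟨hfin.toFinset, fun g hg => ((Set.Finite.mem_toFinset hfin).mp hg).1, ?_⟩
  -- below every non-zero element of `M` there is a minimal one
  have hmin : ∀ γ ∈ M, γ ≠ 0 → ∃ g ∈ A, g ≤ γ := by
    intro γ hγ hγ0
    obtain ⟨g, ⟨hgM, hg0, hgle⟩, hgmin⟩ :=
      (wellFounded_lt (α := Fin m → ℕ)).has_min {g | g ∈ M ∧ g ≠ 0 ∧ g ≤ γ} ⟨γ, hγ, hγ0, le_rfl⟩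
    refine ⟨g, ⟨hgM, hg0, fun g' hg'M hg'0 hg'le => ?_⟩, hgle⟩
    by_contra hne
    exact hgmin g' ⟨hg'M, hg'0, hg'le.trans hgle⟩ (lt_of_le_of_ne hg'le hne)
  -- induction on the size `∑ γᵢ`
  suffices h : ∀ (N : ℕ) (γ : Fin m → ℕ), ∑ i, γ i = N → γ ∈ M →
      ∃ n : (Fin m → ℕ) → ℕ, γ = ∑ g ∈ hfin.toFinset, n g • g from fun γ hγ => h _ γ rfl hγ
  intro N
  induction N using Nat.strong_induction_on with
  | _ N ih =>
    intro γ hN hγ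
    by_cases hγ0 : γ = 0
    · exact ⟨0, by simp [hγ0]⟩
    obtain ⟨g, hgA, hgle⟩ := hmin γ hγ hγ0
    have hgG : g ∈ hfin.toFinset := (Set.Finite.mem_toFinset hfin).mpr hgA
    -- `γ - g` is smaller and lies in `M`
    have hsub : ∑ i, (γ - g) i < N := by
      rw [← hN]
      have hle : ∀ i, (γ - g) i ≤ γ i := fun i => by rw [Pi.sub_apply]; exact Nat.sub_le _ _
      obtain ⟨j, hj⟩ : ∃ j, g j ≠ 0 := Function.ne_iff.mp hgA.2.1
      have hlt : (γ - g) j < γ j := by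
        rw [Pi.sub_apply]; exact Nat.sub_lt (Nat.pos_of_ne_zero (fun h0 => hj (Nat.eq_zero_of_le_zero
          (h0 ▸ hgle j)))) (Nat.pos_of_ne_zero hj)
      exact Finset.sum_lt_sum (fun i _ => hle i) ⟨j, Finset.mem_univ j, hlt⟩
    obtain ⟨n, hn⟩ := ih _ hsub (γ - g) rfl (kernel_tsub_mem δ hgle hγ hgA.1)
    refine ⟨fun g' => n g' + (if g' = g then 1 else 0), ?_⟩
    have hsplit : ∀ g' ∈ hfin.toFinset, (n g' + (if g' = g then 1 else 0)) • g' =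
        n g' • g' + (if g' = g then 1 else 0) • g' := fun g' _ => add_nsmul _ _ _
    rw [Finset.sum_congr rfl hsplit, Finset.sum_add_distrib, ← hn,
      Finset.sum_eq_single g (fun g' _ hne => by rw [if_neg hne, zero_nsmul]) (fun h => absurd hgG h),
      if_pos rfl, one_nsmul]
    exact (tsub_add_cancel_of_le hgle).symm

end Summit.ResolutionOfSingularities.ResolutionOfSingularities.Theorems.WildQuotientResolution.S1.CoarseChart
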